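import Literature.Geometry.Lorentzian.KerrCarterCommutation
import HarnessLib

/-!
# The `T`-energy identity for the Kerr wave equation in the coordinates `(t*, r, θ, φ*)` on
# axisymmetric functions: pointwise divergence form, the identity on coordinate boxes, and the
# conservation of the degenerate energy outside the extremal horizon (Aretakis 2012, Prop. 5.1.2)

(family `gr`; namespace `Literature.Geometry.Lorentzian.Kerr.StarCoord`; written from the proving
seat of `Literature.Barriers.FinalStateConjecture.Aretakis2012_pointwiseDecay` — Aretakis, JFA 263
(2012), Thm. 5. After the reductions of the barrier catalogue
(`ExtremalHorizonSphereSobolev`, `…CarterOperator`, `…ShellEnergyDecay`,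
`…PointwiseDecayFromEnergy`) that named fact rests on the energy estimates of the paper (Thms. 1–2:
integrated local energy decay and uniform boundedness) for axisymmetric solutions on extremal
Kerr; the physical-space proofs of those estimates (§§5–13 of the source) are energy identities for
vector-field multipliers on the region `{r ≥ M}` bounded by two leaves and the horizon. This file
supplies the first of them, for the Killing multiplier `T = ∂_{t*}` (Prop. 5.1.2), in the
coordinates in which the later currents of the paper are written.)

In the coordinates `q = (t*, r, θ, φ*)` of `KerrStarWaveOperator.lean` the Kerr wave operator on
functions `G` with `∂_{φ*}G = 0` is `ρ²□_g = 𝓡 + 𝓐` (`radOp`, `angOp` of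
`KerrCarterCommutation.lean`). Multiplying `𝓡G + 𝓐G` by `sin θ ∂_{t*}G` and using the product
rule gives a pure divergence — the multiplier `T` is Killing, its current has no bulk term:

* `tEnergy M a G` — the `T`-energy density through the leaves `{t* = const}` (with the factor
  `sin θ` of the volume form `ρ² sin θ dr dθ dφ*`):
  `e_T[G] = ½ sin θ (Δ (∂_rG)² + (ρ² + 2Mr)(∂_{t*}G)² + (∂_θG)²)`, `Δ = r² − 2Mr + a²`,
  non-negative where `Δ ≥ 0` and degenerate in `∂_r` at the horizons — the coordinate form of
  Aretakis's `J^T_μ[ψ]n^μ ∼ (Tψ)² + (1 − M/r)²(Yψ)² + |∇̸ψ|²` for `a = M` (§5.1);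
* `tFluxR M a G` — the radial `T`-flux `f_T[G] = sin θ (Δ ∂_rG ∂_{t*}G + 2Mr (∂_{t*}G)²)`, equal on
  the extremal horizon `r = M = a` to `2M² sin θ (∂_{t*}G)² ≥ 0` (`tFluxR_extremal_horizon`);
* `tEnergy_identity` (**pointwise**): on an open `W ⊆ {sin θ ≠ 0}` of smoothness,
  `sin θ ∂_{t*}G (𝓡G + 𝓐G) = ∂_r f_T[G] + ∂_θ(sin θ ∂_θG ∂_{t*}G) − ∂_{t*} e_T[G]`;
* `pd_tEnergy_eq` (**across the axis**): if `𝓡G + 𝓐G = 0` off the axis on an open `W₀` of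
  smoothness, then `∂_{t*} e_T = ∂_r f_T + ∂_θ(sin θ ∂_θG ∂_{t*}G)` at every point of `W₀` (the
  densities are smooth on `W₀`; continuity);
* `tEnergy_box_identity` (**integrated**): for a coordinate box `[t₁, t₂] × [r₁, r₂] × [0, π]`
  (at fixed `φ₀`; `boxPoint`) inside `W₀`,
  `∫₀^π∫_{r₁}^{r₂} e_T(t₂) − ∫₀^π∫_{r₁}^{r₂} e_T(t₁) = ∫_{t₁}^{t₂}∫₀^π (f_T(t, r₂, θ) − f_T(t, r₁, θ)) dθ dt`
  (fundamental theorem of calculus in `t`, `r`, `θ`; Fubini for continuous integrands, via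
  clamped composites `continuous_clampedComp`; the polar flux vanishes at `θ = 0, π`);
* `tEnergy_box_identity_extremal`, `tEnergy_extremal_conservation`, `tEnergy_extremal_antitone`
  (**Prop. 5.1.2 on extremal Kerr, `a = M`, shell `M ≤ r ≤ r₂`**): the change of the degenerate
  `T`-energy between two leaves is the flux through `{r = r₂}` minus the horizon flux
  `∫∫ 2M² sin θ (∂_{t*}G)² ≥ 0`; when nothing flows through `{r = r₂}` the energy does not
  increase and the horizon `T`-flux is bounded by the initial energy.

Everything is proved; no named facts. The passage from a solution `ψ` of `□_g ψ = 0` on the chart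
to `G = ψ ∘ κ` and the hypothesis `𝓡G + 𝓐G = 0` is `Kerr.blSigma_mul_coordWave_starChart`
(`KerrStarWaveOperator.lean`) with the axisymmetry `∂_{φ*}G = 0`, as carried out in the barrier
catalogue (`ExtremalHorizonCarterOperator.lean`, `radOp_add_angOp_eq_zero`).

## References

* S. Aretakis, *Decay of axisymmetric solutions of the wave equation on extreme Kerr backgrounds*,
  J. Funct. Anal. 263 (2012) 2770–2831 (arXiv:1110.2006): §2.4 (the coordinates, `T = ∂_{t*}`),
  §5.1 (Prop. 5.1.1: `J^T_μ[ψ]n^μ_Σ ≥ 0` for axisymmetric `ψ`; the remark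
  `J^T n ∼ (Tψ)² + (1 − M/r)²(Yψ)² + |∇̸ψ|²` and `∫_{𝓗⁺} J^T ≥ 0`; Prop. 5.1.2: conservation of the
  degenerate energy) (key `Aretakis2012`).
* M. Dafermos, I. Rodnianski, *Lectures on black holes and linear waves*, arXiv:0811.0354, App. D
  (`J^V_μ = T_{μν}V^ν`, `K^V`, and the divergence theorem; `K^T = 0` for Killing `T`)
  (key `DafermosRodnianski2008`).
-/

noncomputable section

open Real Set Filter
open scoped Topology ContDiff

namespace Literature.Geometry.Lorentzian

namespace Kerr

namespace StarCoord

variable {W : Set E4}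

/-! ### The `T`-energy density and fluxes in coordinates -/

section Densities

variable (M a : ℝ)

/-- **The `T`-energy density** of `G` through the leaves `{t* = const}` in the coordinates
`(t*, r, θ, φ*)`, including the factor `sin θ` of the volume form `ρ² sin θ dr dθ dφ*` (the factor
`ρ²` is already in the operator `ρ² □_g = 𝓡 + 𝓐`):
`e_T[G] = ½ sin θ (Δ (∂_r G)² + (ρ² + 2Mr)(∂_{t*} G)² + (∂_θ G)²)`, `Δ = r² − 2Mr + a²`,
`ρ² = r² + a² cos² θ` — non-negative for `Δ ≥ 0`, degenerate in `∂_r` at the roots of `Δ` (the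
horizons); for `a = M`, `Δ = (r − M)²`: Aretakis's `J^T_μ[ψ] n^μ ∼ (Tψ)² + (1 − M/r)²(Yψ)² + |∇̸ψ|²`
(JFA 263 (2012), §5.1, remark after Prop. 5.1.1). [cite: Aretakis2012, §5.1] -/
def tEnergy (G : E4 → ℝ) : E4 → ℝ := fun q ↦
  1 / 2 * sin (q 2) * ((q 1 ^ 2 - 2 * M * q 1 + a ^ 2) * pd 1 G q ^ 2 +
    (q 1 ^ 2 + a ^ 2 * cos (q 2) ^ 2 + 2 * M * q 1) * pd 0 G q ^ 2 + pd 2 G q ^ 2)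

/-- **The radial `T`-flux** `f_T[G] = sin θ (Δ ∂_r G ∂_{t*} G + 2Mr (∂_{t*} G)²)`: the flux of the
`T`-energy current through the level sets `{r = const}` (times `sin θ`); on a horizon `Δ = 0` it is
`2Mr sin θ (∂_{t*}G)² ≥ 0` (Aretakis 2012, §5.1: `∫_{𝓗⁺} J^T_μ[ψ] n^μ_{𝓗⁺} ≥ 0`).
[cite: Aretakis2012, §5.1] -/
def tFluxR (G : E4 → ℝ) : E4 → ℝ := fun q ↦
  sin (q 2) * ((q 1 ^ 2 - 2 * M * q 1 + a ^ 2) * pd 1 G q * pd 0 G q + 2 * M * q 1 * pd 0 G q ^ 2)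

/-- **The polar `T`-flux** `sin θ ∂_θ G ∂_{t*} G` (a total `θ`-derivative term vanishing at the
poles). [cite: Aretakis2012, §5.1] -/
def tFluxTheta (G : E4 → ℝ) : E4 → ℝ := fun q ↦ sin (q 2) * pd 2 G q * pd 0 G q

end Densities

/-! ### The pointwise `T`-energy identity -/

section Identity

/-- `dq^j(∂_i) = δ_{ij}`. [folklore] -/
theorem proj_basisVector (i j : Fin 4) :
    (PiLp.proj (𝕜 := ℝ) 2 (fun _ : Fin 4 ↦ ℝ) j) (E4.basisVector i) = if j = i then 1 else 0 := by
  rw [show (PiLp.proj (𝕜 := ℝ) 2 (fun _ : Fin 4 ↦ ℝ) j) (E4.basisVector i) = E4.basisVector i j from rfl]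
  exact PiLp.single_apply _ _ _ _ _

variable {M a : ℝ} (hW : IsOpen W) (hWs : ∀ q ∈ W, sin (q 2) ≠ 0)
include hW

include hWs in
/-- **The `T`-energy identity (pointwise, divergence form).** For `G` smooth on an open set
`W ⊆ {sin θ ≠ 0}` of coordinate space,
`sin θ · ∂_{t*}G · (𝓡 G + 𝓐 G) = ∂_r f_T[G] + ∂_θ (sin θ ∂_θG ∂_{t*}G) − ∂_{t*} e_T[G]` on `W`:
the multiplier `T = ∂_{t*}` is Killing (the coefficients of `ρ²□_g = 𝓡 + 𝓐` do not depend on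
`t*`), so its current has no bulk term — `∇^μ(T_{μν}T^ν) = (□_g ψ) Tψ`, `K^T = 0` (Aretakis 2012,
§5.1, Prop. 5.1.2; Dafermos–Rodnianski, arXiv:0811.0354, App. D) — written out in the coordinates
`(t*, r, θ, φ*)` for functions with `∂_{φ*}G = 0` built into `𝓡`, `𝓐`. Proof: product rule and the
symmetry of mixed partials. [cite: Aretakis2012, §5.1 (Prop. 5.1.2)] -/
theorem tEnergy_identity {G : E4 → ℝ} (hG : ContDiffOn ℝ ∞ G W) :
    EqOn (fun q ↦ sin (q 2) * pd 0 G q * (radOp M a G q + angOp a G q))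
      (fun q ↦ pd 1 (tFluxR M a G) q + pd 2 (tFluxTheta G) q - pd 0 (tEnergy M a G) q) W := by
  intro q hq
  -- smoothness of the derivatives involved
  have h0 := contDiffOn_pd hW hG 0
  have h1 := contDiffOn_pd hW hG 1
  have h2 := contDiffOn_pd hW hG 2
  -- derivatives of the coefficient functions
  have dΔ : HasFDerivAt (fun q : E4 ↦ q 1 ^ 2 - 2 * M * q 1 + a ^ 2)
      ((2 * q 1 - 2 * M) • PiLp.proj (𝕜 := ℝ) 2 (fun _ : Fin 4 ↦ ℝ) 1) q := by
    refine hasFDerivAt_coefFun (f := fun r ↦ r ^ 2 - 2 * M * r + a ^ 2) ?_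
    have h := (((hasDerivAt_id' (q 1)).pow 2).sub ((hasDerivAt_id' (q 1)).const_mul (2 * M))).add_const
      (a ^ 2)
    exact h.congr_deriv (by norm_num)
  have dMr : HasFDerivAt (fun q : E4 ↦ 2 * M * q 1)
      ((2 * M) • PiLp.proj (𝕜 := ℝ) 2 (fun _ : Fin 4 ↦ ℝ) 1) q := by
    refine hasFDerivAt_coefFun (f := fun r ↦ 2 * M * r) ?_
    exact ((hasDerivAt_id' (q 1)).const_mul (2 * M)).congr_deriv (by norm_num)
  have dSig : HasFDerivAt (fun q : E4 ↦ q 1 ^ 2 + a ^ 2 * cos (q 2) ^ 2 + 2 * M * q 1)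
      ((2 * q 1 + 2 * M) • PiLp.proj (𝕜 := ℝ) 2 (fun _ : Fin 4 ↦ ℝ) 1 +
        (a ^ 2 * (2 * cos (q 2) * -sin (q 2))) • PiLp.proj (𝕜 := ℝ) 2 (fun _ : Fin 4 ↦ ℝ) 2) q := by
    have hA : HasFDerivAt (fun q : E4 ↦ q 1 ^ 2 + 2 * M * q 1)
        ((2 * q 1 + 2 * M) • PiLp.proj (𝕜 := ℝ) 2 (fun _ : Fin 4 ↦ ℝ) 1) q := by
      refine hasFDerivAt_coefFun (f := fun r ↦ r ^ 2 + 2 * M * r) ?_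
      exact (((hasDerivAt_id' (q 1)).pow 2).add ((hasDerivAt_id' (q 1)).const_mul (2 * M))).congr_deriv
        (by norm_num)
    have hB : HasFDerivAt (fun q : E4 ↦ a ^ 2 * cos (q 2) ^ 2)
        ((a ^ 2 * (2 * cos (q 2) * -sin (q 2))) • PiLp.proj (𝕜 := ℝ) 2 (fun _ : Fin 4 ↦ ℝ) 2) q := by
      refine hasFDerivAt_coefFun (f := fun θ ↦ a ^ 2 * cos θ ^ 2) ?_
      exact (((hasDerivAt_cos (q 2)).pow 2).const_mul (a ^ 2)).congr_deriv (by norm_num)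
    have h := hA.add hB
    have hfun : (fun q : E4 ↦ q 1 ^ 2 + a ^ 2 * cos (q 2) ^ 2 + 2 * M * q 1) =
        fun q : E4 ↦ (q 1 ^ 2 + 2 * M * q 1) + a ^ 2 * cos (q 2) ^ 2 := by
      funext q; ring
    rw [hfun]
    exact h
  have dsin : HasFDerivAt (fun q : E4 ↦ sin (q 2))
      ((cos (q 2)) • PiLp.proj (𝕜 := ℝ) 2 (fun _ : Fin 4 ↦ ℝ) 2) q :=
    hasFDerivAt_coefFun (f := fun θ ↦ sin θ) (hasDerivAt_sin (q 2))
  have dhalfsin : HasFDerivAt (fun q : E4 ↦ 1 / 2 * sin (q 2))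
      ((1 / 2 * cos (q 2)) • PiLp.proj (𝕜 := ℝ) 2 (fun _ : Fin 4 ↦ ℝ) 2) q := by
    refine hasFDerivAt_coefFun (f := fun θ ↦ 1 / 2 * sin θ) ?_
    exact ((hasDerivAt_sin (q 2)).const_mul (1 / 2)).congr_deriv (by ring)
  -- the derivatives of `G`'s partials at `q`
  have D0 := hasFDerivAt_of_contDiffOn hW h0 hq
  have D1 := hasFDerivAt_of_contDiffOn hW h1 hq
  have D2 := hasFDerivAt_of_contDiffOn hW h2 hq
  -- `∂_r f_T`
  have hF : HasFDerivAt (tFluxR M a G) _ q :=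
    dsin.mul (((dΔ.mul D1).mul D0).add (dMr.mul (D0.pow 2)))
  -- `∂_θ (sin θ ∂_θ G ∂_t G)`
  have hΘ : HasFDerivAt (tFluxTheta G) _ q := (dsin.mul D2).mul D0
  -- `∂_t e_T`
  have hE : HasFDerivAt (tEnergy M a G) _ q :=
    dhalfsin.mul (((dΔ.mul (D1.pow 2)).add (dSig.mul (D0.pow 2))).add (D2.pow 2))
  -- evaluation of the coordinate projections on the basis vectors
  have p11 : (PiLp.proj (𝕜 := ℝ) 2 (fun _ : Fin 4 ↦ ℝ) 1) (E4.basisVector 1) = 1 := by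
    rw [proj_basisVector, if_pos rfl]
  have p22 : (PiLp.proj (𝕜 := ℝ) 2 (fun _ : Fin 4 ↦ ℝ) 2) (E4.basisVector 2) = 1 := by
    rw [proj_basisVector, if_pos rfl]
  have p12 : (PiLp.proj (𝕜 := ℝ) 2 (fun _ : Fin 4 ↦ ℝ) 2) (E4.basisVector 1) = 0 := by
    rw [proj_basisVector, if_neg (by decide)]
  have p01 : (PiLp.proj (𝕜 := ℝ) 2 (fun _ : Fin 4 ↦ ℝ) 1) (E4.basisVector 0) = 0 := by
    rw [proj_basisVector, if_neg (by decide)]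
  have p02 : (PiLp.proj (𝕜 := ℝ) 2 (fun _ : Fin 4 ↦ ℝ) 2) (E4.basisVector 0) = 0 := by
    rw [proj_basisVector, if_neg (by decide)]
  beta_reduce
  rw [pd_apply (G := tFluxR M a G), hF.fderiv, pd_apply (G := tFluxTheta G), hΘ.fderiv,
    pd_apply (G := tEnergy M a G), hE.fderiv]
  simp only [FunLike.coe_add, Pi.add_apply, FunLike.coe_smul, Pi.smul_apply, smul_eq_mul,
    nsmul_eq_mul, Pi.mul_apply, p11, p22, p12, p01, p02, Nat.cast_ofNat, Nat.add_one_sub_one,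
    pow_one, mul_one, mul_zero, add_zero]
  simp only [← pd_apply]
  rw [pd_comm hW hG 0 1 hq, pd_comm hW hG 0 2 hq]
  have hs := hWs q hq
  have hsc := sin_sq_add_cos_sq (q 2)
  simp only [radOp, angOp]
  field_simp
  linear_combination (pd 0 G q * sin (q 2) * a ^ 2 * pd 0 (pd 0 G) q) * hsc

omit hW in
/-- The densities `e_T[G]`, `f_T[G]`, `sin θ ∂_θG ∂_{t*}G` of a smooth `G` are smooth (their
coefficients are polynomials in `r` and `sin θ`, `cos θ` — no division). [folklore] -/
theorem contDiffOn_tEnergy_tFlux (hW₀ : IsOpen W) {G : E4 → ℝ} (hG : ContDiffOn ℝ ∞ G W) :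
    ContDiffOn ℝ ∞ (tEnergy M a G) W ∧ ContDiffOn ℝ ∞ (tFluxR M a G) W ∧
      ContDiffOn ℝ ∞ (tFluxTheta G) W := by
  have h0 := contDiffOn_pd hW₀ hG 0
  have h1 := contDiffOn_pd hW₀ hG 1
  have h2 := contDiffOn_pd hW₀ hG 2
  have hc : ∀ j : Fin 4, ContDiffOn ℝ ∞ (fun q : E4 ↦ q j) W := fun j ↦ (contDiff_coord j).contDiffOn
  have hsin : ContDiffOn ℝ ∞ (fun q : E4 ↦ sin (q 2)) W := contDiff_sin.comp_contDiffOn (hc 2)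
  have hcos : ContDiffOn ℝ ∞ (fun q : E4 ↦ cos (q 2)) W := contDiff_cos.comp_contDiffOn (hc 2)
  have hΔ : ContDiffOn ℝ ∞ (fun q : E4 ↦ q 1 ^ 2 - 2 * M * q 1 + a ^ 2) W :=
    (((hc 1).pow 2).sub (contDiffOn_const.mul (hc 1))).add contDiffOn_const
  have hSig : ContDiffOn ℝ ∞ (fun q : E4 ↦ q 1 ^ 2 + a ^ 2 * cos (q 2) ^ 2 + 2 * M * q 1) W :=
    (((hc 1).pow 2).add (contDiffOn_const.mul (hcos.pow 2))).add (contDiffOn_const.mul (hc 1))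
  refine ⟨?_, ?_, ?_⟩
  · unfold tEnergy
    exact (contDiffOn_const.mul hsin).mul (((hΔ.mul (h1.pow 2)).add (hSig.mul (h0.pow 2))).add (h2.pow 2))
  · unfold tFluxR
    exact hsin.mul (((hΔ.mul h1).mul h0).add ((contDiffOn_const.mul (hc 1)).mul (h0.pow 2)))
  · unfold tFluxTheta
    exact (hsin.mul h2).mul h0

omit hW in
/-- **The `T`-energy identity for solutions, across the axis.** If `G` is smooth on an open set
`W₀` and satisfies the separated equation `𝓡 G + 𝓐 G = 0` at the points of `W₀` off the axis
(`sin θ ≠ 0`), then `∂_{t*} e_T[G] = ∂_r f_T[G] + ∂_θ(sin θ ∂_θG ∂_{t*}G)` at EVERY point of `W₀`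
(off the axis by `tEnergy_identity`; on the axis by continuity — the three densities are smooth
on `W₀`). [cite: Aretakis2012, §5.1 (Prop. 5.1.2)] -/
theorem pd_tEnergy_eq {W₀ : Set E4} (hW₀ : IsOpen W₀) {G : E4 → ℝ} (hG : ContDiffOn ℝ ∞ G W₀)
    (hP : ∀ q ∈ W₀, sin (q 2) ≠ 0 → radOp M a G q + angOp a G q = 0) :
    ∀ q ∈ W₀, pd 0 (tEnergy M a G) q = pd 1 (tFluxR M a G) q + pd 2 (tFluxTheta G) q := by
  -- off the axis
  set W : Set E4 := W₀ ∩ {q : E4 | sin (q 2) ≠ 0} with hWdef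
  have hW : IsOpen W :=
    hW₀.inter (isOpen_ne_fun (continuous_sin.comp (PiLp.continuous_apply 2 _ 2)) continuous_const)
  have hWs : ∀ q ∈ W, sin (q 2) ≠ 0 := fun q hq ↦ hq.2
  have hGW : ContDiffOn ℝ ∞ G W := hG.mono inter_subset_left
  have hoff : ∀ q ∈ W, pd 0 (tEnergy M a G) q = pd 1 (tFluxR M a G) q + pd 2 (tFluxTheta G) q := by
    intro q hq
    have h := tEnergy_identity (M := M) (a := a) hW hWs hGW hq
    simp only [hP q hq.1 hq.2, mul_zero] at h
    linarith
  -- the defect is continuous on `W₀`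
  obtain ⟨hE, hF, hΘ⟩ := contDiffOn_tEnergy_tFlux (M := M) (a := a) hW₀ hG
  set D : E4 → ℝ := fun q ↦ pd 0 (tEnergy M a G) q - pd 1 (tFluxR M a G) q - pd 2 (tFluxTheta G) q
    with hDdef
  have hDc : ContinuousOn D W₀ :=
    (((contDiffOn_pd hW₀ hE 0).continuousOn).sub (contDiffOn_pd hW₀ hF 1).continuousOn).sub
      (contDiffOn_pd hW₀ hΘ 2).continuousOn
  have hD0 : ∀ q ∈ W, D q = 0 := fun q hq ↦ by
    simp only [hDdef, hoff q hq]; ring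
  intro q hq
  suffices h : D q = 0 by
    simp only [hDdef] at h; linarith
  by_cases hs : sin (q 2) ≠ 0
  · exact hD0 q ⟨hq, hs⟩
  push Not at hs
  -- approach the axis point along `s ↦ q + s ∂₂`
  set γ : ℝ → E4 := fun s ↦ q + s • E4.basisVector 2 with hγ
  have hγc : Continuous γ := continuous_const.add (continuous_id.smul continuous_const)
  have hγ0 : γ 0 = q := by simp [hγ]
  have hev : ∀ᶠ s in 𝓝 (0 : ℝ), γ s ∈ W₀ :=
    hγc.continuousAt.preimage_mem_nhds (by rw [hγ0]; exact hW₀.mem_nhds hq)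
  have hcos : cos (q 2) ≠ 0 := by
    intro hc
    have := sin_sq_add_cos_sq (q 2)
    rw [hs, hc] at this
    norm_num at this
  have hsmall : ∀ᶠ s in 𝓝[≠] (0 : ℝ), sin s ≠ 0 := by
    have h1 : ∀ᶠ s in 𝓝 (0 : ℝ), s ∈ Ioo (-π) π := Ioo_mem_nhds (by linarith [pi_pos]) pi_pos
    filter_upwards [mem_nhdsWithin_of_mem_nhds h1, self_mem_nhdsWithin] with s hs1 hs0
    intro h0
    rcases lt_or_gt_of_ne hs0 with hneg | hpos
    · have := sin_neg_of_neg_of_neg_pi_lt hneg hs1.1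
      linarith
    · have := sin_pos_of_pos_of_lt_pi hpos hs1.2
      linarith
  have hev' : ∀ᶠ s in 𝓝[≠] (0 : ℝ), D (γ s) = 0 := by
    filter_upwards [mem_nhdsWithin_of_mem_nhds hev, hsmall] with s hsW₀ hss
    refine hD0 _ ⟨hsW₀, ?_⟩
    show sin ((q + s • E4.basisVector 2) 2) ≠ 0
    rw [add_smul_basisVector_apply, if_pos rfl, sin_add, hs, zero_mul, zero_add]
    exact mul_ne_zero hcos hss
  have htend : Tendsto (fun s ↦ D (γ s)) (𝓝[≠] 0) (𝓝 (D q)) := by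
    have h1 : Tendsto γ (𝓝[≠] 0) (𝓝[W₀] q) := by
      refine tendsto_nhdsWithin_iff.2 ⟨?_, mem_nhdsWithin_of_mem_nhds hev⟩
      rw [← hγ0]
      exact hγc.continuousAt.tendsto.mono_left nhdsWithin_le_nhds
    exact (hDc _ hq).tendsto.comp h1
  have hconst : Tendsto (fun s ↦ D (γ s)) (𝓝[≠] 0) (𝓝 0) :=
    tendsto_const_nhds.congr' (hev'.mono fun s h ↦ h.symm)
  exact tendsto_nhds_unique htend hconst

end Identity

/-! ### Coordinate boxes: the points `(t, r, θ, φ₀)`, clamping, and Fubini for continuous integrands -/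

section Box

/-- The coordinate quadruple `(t, r, θ, φ₀)` as a point of coordinate space. [folklore] -/
def boxPoint (φ₀ t r θ : ℝ) : E4 := WithLp.toLp 2 ![t, r, θ, φ₀]

/-- Component. [folklore] -/
@[simp] theorem boxPoint_apply_zero (φ₀ t r θ : ℝ) : boxPoint φ₀ t r θ 0 = t := rfl
/-- Component. [folklore] -/
@[simp] theorem boxPoint_apply_one (φ₀ t r θ : ℝ) : boxPoint φ₀ t r θ 1 = r := rfl
/-- Component. [folklore] -/
@[simp] theorem boxPoint_apply_two (φ₀ t r θ : ℝ) : boxPoint φ₀ t r θ 2 = θ := rfl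
/-- Component. [folklore] -/
@[simp] theorem boxPoint_apply_three (φ₀ t r θ : ℝ) : boxPoint φ₀ t r θ 3 = φ₀ := rfl

/-- The `t`-lines of the box. [folklore] -/
theorem boxPoint_t_eq (φ₀ t r θ : ℝ) : boxPoint φ₀ t r θ = boxPoint φ₀ 0 r θ + t • E4.basisVector 0 := by
  ext i
  rw [add_smul_basisVector_apply]
  fin_cases i <;> simp

/-- The `r`-lines of the box. [folklore] -/
theorem boxPoint_r_eq (φ₀ t r θ : ℝ) : boxPoint φ₀ t r θ = boxPoint φ₀ t 0 θ + r • E4.basisVector 1 := by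
  ext i
  rw [add_smul_basisVector_apply]
  fin_cases i <;> simp

/-- The `θ`-lines of the box. [folklore] -/
theorem boxPoint_theta_eq (φ₀ t r θ : ℝ) : boxPoint φ₀ t r θ = boxPoint φ₀ t r 0 + θ • E4.basisVector 2 := by
  ext i
  rw [add_smul_basisVector_apply]
  fin_cases i <;> simp

/-- Derivative of a function along the `t`-lines: `∂_t [H(t, r, θ, φ₀)] = ∂₀H`. [folklore] -/
theorem hasDerivAt_comp_boxPoint_t {H : E4 → ℝ} {φ₀ t r θ : ℝ} (hH : DifferentiableAt ℝ H (boxPoint φ₀ t r θ)) :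
    HasDerivAt (fun t' ↦ H (boxPoint φ₀ t' r θ)) (pd 0 H (boxPoint φ₀ t r θ)) t := by
  have hline : HasDerivAt (fun t' : ℝ ↦ boxPoint φ₀ t' r θ) (E4.basisVector 0) t := by
    have hfun : (fun t' : ℝ ↦ boxPoint φ₀ t' r θ) = fun t' ↦ boxPoint φ₀ 0 r θ + t' • E4.basisVector 0 :=
      funext fun t' ↦ boxPoint_t_eq φ₀ t' r θ
    rw [hfun]
    simpa using ((hasDerivAt_id t).smul_const (E4.basisVector 0)).const_add (boxPoint φ₀ 0 r θ)
  exact hH.hasFDerivAt.comp_hasDerivAt t hline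

/-- Derivative along the `r`-lines: `∂_r [H(t, r, θ, φ₀)] = ∂₁H`. [folklore] -/
theorem hasDerivAt_comp_boxPoint_r {H : E4 → ℝ} {φ₀ t r θ : ℝ} (hH : DifferentiableAt ℝ H (boxPoint φ₀ t r θ)) :
    HasDerivAt (fun r' ↦ H (boxPoint φ₀ t r' θ)) (pd 1 H (boxPoint φ₀ t r θ)) r := by
  have hline : HasDerivAt (fun r' : ℝ ↦ boxPoint φ₀ t r' θ) (E4.basisVector 1) r := by
    have hfun : (fun r' : ℝ ↦ boxPoint φ₀ t r' θ) = fun r' ↦ boxPoint φ₀ t 0 θ + r' • E4.basisVector 1 :=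
      funext fun r' ↦ boxPoint_r_eq φ₀ t r' θ
    rw [hfun]
    simpa using ((hasDerivAt_id r).smul_const (E4.basisVector 1)).const_add (boxPoint φ₀ t 0 θ)
  exact hH.hasFDerivAt.comp_hasDerivAt r hline

/-- Derivative along the `θ`-lines: `∂_θ [H(t, r, θ, φ₀)] = ∂₂H`. [folklore] -/
theorem hasDerivAt_comp_boxPoint_theta {H : E4 → ℝ} {φ₀ t r θ : ℝ}
    (hH : DifferentiableAt ℝ H (boxPoint φ₀ t r θ)) :
    HasDerivAt (fun θ' ↦ H (boxPoint φ₀ t r θ')) (pd 2 H (boxPoint φ₀ t r θ)) θ := by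
  have hline : HasDerivAt (fun θ' : ℝ ↦ boxPoint φ₀ t r θ') (E4.basisVector 2) θ := by
    have hfun : (fun θ' : ℝ ↦ boxPoint φ₀ t r θ') = fun θ' ↦ boxPoint φ₀ t r 0 + θ' • E4.basisVector 2 :=
      funext fun θ' ↦ boxPoint_theta_eq φ₀ t r θ'
    rw [hfun]
    simpa using ((hasDerivAt_id θ).smul_const (E4.basisVector 2)).const_add (boxPoint φ₀ t r 0)
  exact hH.hasFDerivAt.comp_hasDerivAt θ hline

/-- Joint continuity of `(t, r, θ) ↦ (t, r, θ, φ₀)`. [folklore] -/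
theorem continuous_boxPoint (φ₀ : ℝ) : Continuous fun p : ℝ × ℝ × ℝ ↦ boxPoint φ₀ p.1 p.2.1 p.2.2 := by
  have c0 : Continuous fun p : ℝ × ℝ × ℝ ↦ p.1 := continuous_fst
  have c1 : Continuous fun p : ℝ × ℝ × ℝ ↦ p.2.1 := continuous_fst.comp continuous_snd
  have c2 : Continuous fun p : ℝ × ℝ × ℝ ↦ p.2.2 := continuous_snd.comp continuous_snd
  have c3 : Continuous fun _ : ℝ × ℝ × ℝ ↦ φ₀ := continuous_const
  unfold boxPoint
  refine (PiLp.continuous_toLp 2 _).comp (continuous_pi fun i ↦ ?_)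
  fin_cases i
  · simpa using c0
  · simpa using c1
  · simpa using c2
  · simpa using c3

/-- The clamp `x ↦ max a (min x b)` takes values in `[a, b]` (`a ≤ b`) (private duplicate of
`Literature.MathematicalPhysics.KineticTheory.clamp_mem`, an unrelated file not imported here).
[folklore] -/
private theorem clamp_mem {a b : ℝ} (hab : a ≤ b) (x : ℝ) : max a (min x b) ∈ Icc a b :=
  ⟨le_max_left _ _, max_le hab (min_le_right _ _)⟩

/-- The clamp is the identity on `[a, b]` (private duplicate of `KineticTheory.clamp_eq_self`).
[folklore] -/
private theorem clamp_eq {a b x : ℝ} (hx : x ∈ Icc a b) : max a (min x b) = x := by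
  rw [min_eq_left hx.2, max_eq_right hx.1]

/-- The clamp is continuous. [folklore] -/
theorem continuous_clamp (a b : ℝ) : Continuous fun x : ℝ ↦ max a (min x b) :=
  continuous_const.max (continuous_id.min continuous_const)

/-- **Clamped composites are globally continuous**: if `H` is continuous on `W₀` and the box
`[t₁, t₂] × [r₁, r₂] × [0, π]` (at `φ₀`) is mapped into `W₀`, then
`(t, r, θ) ↦ H((clamp t, clamp r, clamp θ, φ₀))` is continuous on `ℝ³`. [folklore] -/
theorem continuous_clampedComp {W₀ : Set E4} {H : E4 → ℝ} (hH : ContinuousOn H W₀) {t₁ t₂ r₁ r₂ φ₀ : ℝ}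
    (ht : t₁ ≤ t₂) (hr : r₁ ≤ r₂)
    (hbox : ∀ t ∈ Icc t₁ t₂, ∀ r ∈ Icc r₁ r₂, ∀ θ ∈ Icc 0 π, boxPoint φ₀ t r θ ∈ W₀) :
    Continuous fun p : ℝ × ℝ × ℝ ↦
      H (boxPoint φ₀ (max t₁ (min p.1 t₂)) (max r₁ (min p.2.1 r₂)) (max 0 (min p.2.2 π))) := by
  have hc : Continuous fun p : ℝ × ℝ × ℝ ↦
      boxPoint φ₀ (max t₁ (min p.1 t₂)) (max r₁ (min p.2.1 r₂)) (max 0 (min p.2.2 π)) :=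
    (continuous_boxPoint φ₀).comp (Continuous.prodMk ((continuous_clamp t₁ t₂).comp continuous_fst)
      (Continuous.prodMk ((continuous_clamp r₁ r₂).comp (continuous_fst.comp continuous_snd))
        ((continuous_clamp 0 π).comp (continuous_snd.comp continuous_snd))))
  exact hH.comp_continuous hc fun p ↦ hbox _ (clamp_mem ht _) _ (clamp_mem hr _) _
    (clamp_mem pi_pos.le _)

/-- Fubini for a continuous integrand on a rectangle, in interval-integral form (private duplicate of
the barrier catalogue's `Kerr.intervalIntegral_swap_of_continuous`, which a geometry file must not
import). [folklore] -/
private theorem intervalIntegral_swap_continuous {f : ℝ → ℝ → ℝ} (hf : Continuous (Function.uncurry f))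
    {a b c d : ℝ} (hab : a ≤ b) (hcd : c ≤ d) :
    ∫ x in a..b, ∫ y in c..d, f x y = ∫ y in c..d, ∫ x in a..b, f x y := by
  simp only [intervalIntegral.integral_of_le hab, intervalIntegral.integral_of_le hcd]
  have hint : MeasureTheory.Integrable (Function.uncurry f)
      (((MeasureTheory.volume : MeasureTheory.Measure ℝ).restrict (Ioc a b)).prod
        ((MeasureTheory.volume : MeasureTheory.Measure ℝ).restrict (Ioc c d))) := by
    rw [MeasureTheory.Measure.prod_restrict, ← MeasureTheory.Measure.volume_eq_prod]
    exact (hf.continuousOn.integrableOn_compact (isCompact_Icc.prod isCompact_Icc)).mono_set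
      (Set.prod_mono Ioc_subset_Icc_self Ioc_subset_Icc_self)
  exact MeasureTheory.integral_integral_swap hint

end Box

/-! ### The integrated `T`-energy identity on a coordinate box -/

section BoxIdentity

variable {M a : ℝ}

/-- **The `T`-energy identity on a coordinate box** `[t₁, t₂] × [r₁, r₂] × [0, π]` (at fixed `φ₀`;
axisymmetric functions do not depend on `φ*`). If `G` is smooth on an open set `W₀` of coordinate
space containing the box and satisfies `𝓡 G + 𝓐 G = 0` off the axis on `W₀`, then
`∫₀^π∫_{r₁}^{r₂} e_T[G](t₂) dr dθ − ∫₀^π∫_{r₁}^{r₂} e_T[G](t₁) dr dθ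
   = ∫_{t₁}^{t₂}∫₀^π (f_T[G](t, r₂, θ) − f_T[G](t, r₁, θ)) dθ dt`:
the change of the `T`-energy of the shell `{r₁ ≤ r ≤ r₂}` between the leaves `{t* = t₁}` and
`{t* = t₂}` is the time-integrated radial `T`-flux through its two boundary cylinders (the polar
flux `sin θ ∂_θG ∂_{t*}G` integrates to zero over `θ ∈ [0, π]`). This is Stokes' theorem for the
`T`-current on the coordinate box — Aretakis, JFA 263 (2012), §5.1, Prop. 5.1.2 (conservation of
the degenerate energy, `K^T = 0`) and Dafermos–Rodnianski, arXiv:0811.0354, App. D — proved by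
the fundamental theorem of calculus in `t`, `r`, `θ` and Fubini for continuous integrands.
[cite: Aretakis2012, §5.1 (Prop. 5.1.2)] -/
theorem tEnergy_box_identity {W₀ : Set E4} (hW₀ : IsOpen W₀) {G : E4 → ℝ} (hG : ContDiffOn ℝ ∞ G W₀)
    (hP : ∀ q ∈ W₀, sin (q 2) ≠ 0 → radOp M a G q + angOp a G q = 0)
    {t₁ t₂ r₁ r₂ φ₀ : ℝ} (ht : t₁ ≤ t₂) (hr : r₁ ≤ r₂)
    (hbox : ∀ t ∈ Icc t₁ t₂, ∀ r ∈ Icc r₁ r₂, ∀ θ ∈ Icc 0 π, boxPoint φ₀ t r θ ∈ W₀) :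
    (∫ θ in (0 : ℝ)..π, ∫ r in r₁..r₂, tEnergy M a G (boxPoint φ₀ t₂ r θ)) -
        (∫ θ in (0 : ℝ)..π, ∫ r in r₁..r₂, tEnergy M a G (boxPoint φ₀ t₁ r θ)) =
      ∫ t in t₁..t₂, ∫ θ in (0 : ℝ)..π,
        (tFluxR M a G (boxPoint φ₀ t r₂ θ) - tFluxR M a G (boxPoint φ₀ t r₁ θ)) := by
  have hπ : (0 : ℝ) ≤ π := pi_pos.le
  obtain ⟨hE, hF, hΘ⟩ := contDiffOn_tEnergy_tFlux (M := M) (a := a) hW₀ hG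
  have hD := pd_tEnergy_eq (M := M) (a := a) hW₀ hG hP
  -- names for the densities
  set E : E4 → ℝ := tEnergy M a G with hEdef
  set F : E4 → ℝ := tFluxR M a G with hFdef
  set Θ : E4 → ℝ := tFluxTheta G with hΘdef
  -- continuity on `W₀` and differentiability at its points
  have cE : ContinuousOn E W₀ := hE.continuousOn
  have cF : ContinuousOn F W₀ := hF.continuousOn
  have cdF : ContinuousOn (pd 1 F) W₀ := (contDiffOn_pd hW₀ hF 1).continuousOn
  have cdΘ : ContinuousOn (pd 2 Θ) W₀ := (contDiffOn_pd hW₀ hΘ 2).continuousOn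
  have dE : ∀ q ∈ W₀, DifferentiableAt ℝ E q := fun q hq ↦
    (hE.contDiffAt (hW₀.mem_nhds hq)).differentiableAt (by simp)
  have dF : ∀ q ∈ W₀, DifferentiableAt ℝ F q := fun q hq ↦
    (hF.contDiffAt (hW₀.mem_nhds hq)).differentiableAt (by simp)
  have dΘ : ∀ q ∈ W₀, DifferentiableAt ℝ Θ q := fun q hq ↦
    (hΘ.contDiffAt (hW₀.mem_nhds hq)).differentiableAt (by simp)
  -- clamps are the identity on the box
  have ct_eq : ∀ t ∈ Icc t₁ t₂, max t₁ (min t t₂) = t := fun t ht' ↦ clamp_eq ht'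
  have cr_eq : ∀ r ∈ Icc r₁ r₂, max r₁ (min r r₂) = r := fun r hr' ↦ clamp_eq hr'
  have cθ_eq : ∀ θ ∈ Icc (0 : ℝ) π, max 0 (min θ π) = θ := fun θ hθ ↦ clamp_eq hθ
  have ht₁ : t₁ ∈ Icc t₁ t₂ := left_mem_Icc.mpr ht
  have ht₂ : t₂ ∈ Icc t₁ t₂ := right_mem_Icc.mpr ht
  have hr₁ : r₁ ∈ Icc r₁ r₂ := left_mem_Icc.mpr hr
  have hr₂ : r₂ ∈ Icc r₁ r₂ := right_mem_Icc.mpr hr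
  -- clamped, globally continuous integrands
  obtain ⟨cEf, hcEf⟩ : ∃ f : ℝ → ℝ → ℝ → ℝ, f = fun t r θ ↦
      E (boxPoint φ₀ (max t₁ (min t t₂)) (max r₁ (min r r₂)) (max 0 (min θ π))) := ⟨_, rfl⟩
  obtain ⟨gF, hgF⟩ : ∃ f : ℝ → ℝ → ℝ → ℝ, f = fun t r θ ↦
      pd 1 F (boxPoint φ₀ (max t₁ (min t t₂)) (max r₁ (min r r₂)) (max 0 (min θ π))) := ⟨_, rfl⟩
  obtain ⟨gΘ, hgΘ⟩ : ∃ f : ℝ → ℝ → ℝ → ℝ, f = fun t r θ ↦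
      pd 2 Θ (boxPoint φ₀ (max t₁ (min t t₂)) (max r₁ (min r r₂)) (max 0 (min θ π))) := ⟨_, rfl⟩
  obtain ⟨fF, hfF⟩ : ∃ f : ℝ → ℝ → ℝ → ℝ, f = fun t r θ ↦
      F (boxPoint φ₀ (max t₁ (min t t₂)) (max r₁ (min r r₂)) (max 0 (min θ π))) := ⟨_, rfl⟩
  have ccE : Continuous fun p : ℝ × ℝ × ℝ ↦ cEf p.1 p.2.1 p.2.2 := by
    rw [hcEf]; exact continuous_clampedComp cE ht hr hbox
  have cgF : Continuous fun p : ℝ × ℝ × ℝ ↦ gF p.1 p.2.1 p.2.2 := by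
    rw [hgF]; exact continuous_clampedComp cdF ht hr hbox
  have cgΘ : Continuous fun p : ℝ × ℝ × ℝ ↦ gΘ p.1 p.2.1 p.2.2 := by
    rw [hgΘ]; exact continuous_clampedComp cdΘ ht hr hbox
  have cfF : Continuous fun p : ℝ × ℝ × ℝ ↦ fF p.1 p.2.1 p.2.2 := by
    rw [hfF]; exact continuous_clampedComp cF ht hr hbox
  -- the coordinate embeddings used to slice these functions
  have m_t : ∀ r θ : ℝ, Continuous fun t : ℝ ↦ ((t, r, θ) : ℝ × ℝ × ℝ) := fun r θ ↦
    Continuous.prodMk continuous_id continuous_const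
  have m_r : ∀ t θ : ℝ, Continuous fun r : ℝ ↦ ((t, r, θ) : ℝ × ℝ × ℝ) := fun t θ ↦
    Continuous.prodMk continuous_const (Continuous.prodMk continuous_id continuous_const)
  have m_θ : ∀ t r : ℝ, Continuous fun θ : ℝ ↦ ((t, r, θ) : ℝ × ℝ × ℝ) := fun t r ↦
    Continuous.prodMk continuous_const (Continuous.prodMk continuous_const continuous_id)
  have m_rθ : ∀ t : ℝ, Continuous fun p : ℝ × ℝ ↦ ((t, p.1, p.2) : ℝ × ℝ × ℝ) := fun t ↦
    Continuous.prodMk continuous_const continuous_id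
  have m_θr : ∀ t : ℝ, Continuous fun p : ℝ × ℝ ↦ ((t, p.2, p.1) : ℝ × ℝ × ℝ) := fun t ↦
    Continuous.prodMk continuous_const (Continuous.prodMk continuous_snd continuous_fst)
  have m_rt : ∀ θ : ℝ, Continuous fun p : ℝ × ℝ ↦ ((p.2, p.1, θ) : ℝ × ℝ × ℝ) := fun θ ↦
    Continuous.prodMk continuous_snd (Continuous.prodMk continuous_fst continuous_const)
  have m_θt : ∀ r : ℝ, Continuous fun p : ℝ × ℝ ↦ ((p.2, r, p.1) : ℝ × ℝ × ℝ) := fun r ↦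
    Continuous.prodMk continuous_snd (Continuous.prodMk continuous_const continuous_fst)
  have m_rθt : Continuous fun p : (ℝ × ℝ) × ℝ ↦ ((p.2, p.1.1, p.1.2) : ℝ × ℝ × ℝ) :=
    Continuous.prodMk continuous_snd (Continuous.prodMk (continuous_fst.comp continuous_fst)
      (continuous_snd.comp continuous_fst))
  have m_θrt : Continuous fun p : (ℝ × ℝ) × ℝ ↦ ((p.2, p.1.2, p.1.1) : ℝ × ℝ × ℝ) :=
    Continuous.prodMk continuous_snd (Continuous.prodMk (continuous_snd.comp continuous_fst)
      (continuous_fst.comp continuous_fst))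
  /- Step 1: fundamental theorem of calculus in `t`, pointwise in `(r, θ)` of the box -/
  have step1 : ∀ r ∈ Icc r₁ r₂, ∀ θ ∈ Icc (0 : ℝ) π,
      E (boxPoint φ₀ t₂ r θ) - E (boxPoint φ₀ t₁ r θ) = ∫ t in t₁..t₂, (gF t r θ + gΘ t r θ) := by
    intro r hr' θ hθ
    have hderiv : ∀ t ∈ uIcc t₁ t₂, HasDerivAt (fun t' ↦ E (boxPoint φ₀ t' r θ))
        (gF t r θ + gΘ t r θ) t := by
      intro t ht'
      rw [uIcc_of_le ht] at ht'
      have hq := hbox t ht' r hr' θ hθ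
      have h := hasDerivAt_comp_boxPoint_t (dE _ hq)
      rw [hD _ hq] at h
      simp only [hgF, hgΘ, ct_eq t ht', cr_eq r hr', cθ_eq θ hθ]
      exact h
    have hc1 : Continuous fun t ↦ gF t r θ := cgF.comp (m_t r θ)
    have hc2 : Continuous fun t ↦ gΘ t r θ := cgΘ.comp (m_t r θ)
    have hcont : Continuous fun t ↦ gF t r θ + gΘ t r θ := hc1.add hc2
    rw [intervalIntegral.integral_eq_sub_of_hasDerivAt hderiv (hcont.intervalIntegrable _ _)]
  /- Step 2: the left-hand side as a box integral of the `t`-integrals -/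
  have hEint : ∀ t ∈ Icc t₁ t₂, (∫ θ in (0 : ℝ)..π, ∫ r in r₁..r₂, E (boxPoint φ₀ t r θ)) =
      ∫ θ in (0 : ℝ)..π, ∫ r in r₁..r₂, cEf t r θ := by
    intro t ht'
    refine intervalIntegral.integral_congr fun θ hθ ↦ ?_
    rw [uIcc_of_le hπ] at hθ
    refine intervalIntegral.integral_congr fun r hr' ↦ ?_
    rw [uIcc_of_le hr] at hr'
    simp only [hcEf, ct_eq t ht', cr_eq r hr', cθ_eq θ hθ]
  have cE_r : ∀ t θ, Continuous fun r ↦ cEf t r θ := fun t θ ↦ ccE.comp (m_r t θ)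
  have cE_θ : ∀ t, Continuous fun θ ↦ ∫ r in r₁..r₂, cEf t r θ := by
    intro t
    have h : Continuous (Function.uncurry fun θ r ↦ cEf t r θ) := ccE.comp (m_θr t)
    exact intervalIntegral.continuous_parametric_intervalIntegral_of_continuous' h r₁ r₂
  have hlhs : (∫ θ in (0 : ℝ)..π, ∫ r in r₁..r₂, E (boxPoint φ₀ t₂ r θ)) -
      (∫ θ in (0 : ℝ)..π, ∫ r in r₁..r₂, E (boxPoint φ₀ t₁ r θ)) =
      ∫ θ in (0 : ℝ)..π, ∫ r in r₁..r₂, ∫ t in t₁..t₂, (gF t r θ + gΘ t r θ) := by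
    rw [hEint t₂ ht₂, hEint t₁ ht₁,
      ← intervalIntegral.integral_sub ((cE_θ t₂).intervalIntegrable _ _) ((cE_θ t₁).intervalIntegrable _ _)]
    refine intervalIntegral.integral_congr fun θ hθ ↦ ?_
    rw [uIcc_of_le hπ] at hθ
    rw [← intervalIntegral.integral_sub ((cE_r t₂ θ).intervalIntegrable _ _)
      ((cE_r t₁ θ).intervalIntegrable _ _)]
    refine intervalIntegral.integral_congr fun r hr' ↦ ?_
    rw [uIcc_of_le hr] at hr'
    rw [← step1 r hr' θ hθ]
    simp only [hcEf, ct_eq t₂ ht₂, ct_eq t₁ ht₁, cr_eq r hr', cθ_eq θ hθ]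
  rw [hlhs]
  /- Step 3: split the `t`-integral and the box integrals -/
  have cF_t : ∀ r θ, Continuous fun t ↦ gF t r θ := fun r θ ↦ cgF.comp (m_t r θ)
  have cΘ_t : ∀ r θ, Continuous fun t ↦ gΘ t r θ := fun r θ ↦ cgΘ.comp (m_t r θ)
  have hIF : ∀ θ, Continuous fun r ↦ ∫ t in t₁..t₂, gF t r θ := by
    intro θ
    have h : Continuous (Function.uncurry fun r t ↦ gF t r θ) := cgF.comp (m_rt θ)
    exact intervalIntegral.continuous_parametric_intervalIntegral_of_continuous' h t₁ t₂
  have hIΘ : ∀ θ, Continuous fun r ↦ ∫ t in t₁..t₂, gΘ t r θ := by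
    intro θ
    have h : Continuous (Function.uncurry fun r t ↦ gΘ t r θ) := cgΘ.comp (m_rt θ)
    exact intervalIntegral.continuous_parametric_intervalIntegral_of_continuous' h t₁ t₂
  have hIF2 : Continuous fun p : ℝ × ℝ ↦ ∫ t in t₁..t₂, gF t p.1 p.2 := by
    have h : Continuous (Function.uncurry fun (p : ℝ × ℝ) t ↦ gF t p.1 p.2) := cgF.comp m_rθt
    exact intervalIntegral.continuous_parametric_intervalIntegral_of_continuous' h t₁ t₂
  have hIΘ2 : Continuous fun p : ℝ × ℝ ↦ ∫ t in t₁..t₂, gΘ t p.1 p.2 := by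
    have h : Continuous (Function.uncurry fun (p : ℝ × ℝ) t ↦ gΘ t p.1 p.2) := cgΘ.comp m_rθt
    exact intervalIntegral.continuous_parametric_intervalIntegral_of_continuous' h t₁ t₂
  have hIF3 : Continuous fun θ ↦ ∫ r in r₁..r₂, ∫ t in t₁..t₂, gF t r θ := by
    have h : Continuous (Function.uncurry fun θ r ↦ ∫ t in t₁..t₂, gF t r θ) :=
      hIF2.comp (Continuous.prodMk continuous_snd continuous_fst)
    exact intervalIntegral.continuous_parametric_intervalIntegral_of_continuous' h r₁ r₂
  have hIΘ3 : Continuous fun θ ↦ ∫ r in r₁..r₂, ∫ t in t₁..t₂, gΘ t r θ := by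
    have h : Continuous (Function.uncurry fun θ r ↦ ∫ t in t₁..t₂, gΘ t r θ) :=
      hIΘ2.comp (Continuous.prodMk continuous_snd continuous_fst)
    exact intervalIntegral.continuous_parametric_intervalIntegral_of_continuous' h r₁ r₂
  have hsplit : (∫ θ in (0 : ℝ)..π, ∫ r in r₁..r₂, ∫ t in t₁..t₂, (gF t r θ + gΘ t r θ)) =
      (∫ θ in (0 : ℝ)..π, ∫ r in r₁..r₂, ∫ t in t₁..t₂, gF t r θ) +
        ∫ θ in (0 : ℝ)..π, ∫ r in r₁..r₂, ∫ t in t₁..t₂, gΘ t r θ := by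
    rw [← intervalIntegral.integral_add (hIF3.intervalIntegrable _ _) (hIΘ3.intervalIntegrable _ _)]
    refine intervalIntegral.integral_congr fun θ _ ↦ ?_
    rw [← intervalIntegral.integral_add ((hIF θ).intervalIntegrable _ _) ((hIΘ θ).intervalIntegrable _ _)]
    refine intervalIntegral.integral_congr fun r _ ↦ ?_
    exact intervalIntegral.integral_add ((cF_t r θ).intervalIntegrable _ _)
      ((cΘ_t r θ).intervalIntegrable _ _)
  rw [hsplit]
  /- Term B: the polar flux integrates to zero -/
  have hB : (∫ θ in (0 : ℝ)..π, ∫ r in r₁..r₂, ∫ t in t₁..t₂, gΘ t r θ) = 0 := by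
    have s1 : (∫ θ in (0 : ℝ)..π, ∫ r in r₁..r₂, ∫ t in t₁..t₂, gΘ t r θ) =
        ∫ r in r₁..r₂, ∫ θ in (0 : ℝ)..π, ∫ t in t₁..t₂, gΘ t r θ := by
      have h : Continuous (Function.uncurry fun θ r ↦ ∫ t in t₁..t₂, gΘ t r θ) :=
        hIΘ2.comp (Continuous.prodMk continuous_snd continuous_fst)
      exact intervalIntegral_swap_continuous h hπ hr
    rw [s1]
    refine intervalIntegral.integral_zero_ae (Filter.Eventually.of_forall fun r hr' ↦ ?_)
    rw [uIoc_of_le hr] at hr'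
    have hr'' : r ∈ Icc r₁ r₂ := ⟨hr'.1.le, hr'.2⟩
    have s2 : (∫ θ in (0 : ℝ)..π, ∫ t in t₁..t₂, gΘ t r θ) = ∫ t in t₁..t₂, ∫ θ in (0 : ℝ)..π, gΘ t r θ := by
      have h : Continuous (Function.uncurry fun θ t ↦ gΘ t r θ) := cgΘ.comp (m_θt r)
      exact intervalIntegral_swap_continuous h hπ ht
    rw [s2]
    refine intervalIntegral.integral_zero_ae (Filter.Eventually.of_forall fun t ht' ↦ ?_)
    rw [uIoc_of_le ht] at ht'
    have ht'' : t ∈ Icc t₁ t₂ := ⟨ht'.1.le, ht'.2⟩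
    have hderiv : ∀ θ ∈ uIcc (0 : ℝ) π, HasDerivAt (fun θ' ↦ Θ (boxPoint φ₀ t r θ')) (gΘ t r θ) θ := by
      intro θ hθ
      rw [uIcc_of_le hπ] at hθ
      have hq := hbox t ht'' r hr'' θ hθ
      have h := hasDerivAt_comp_boxPoint_theta (dΘ _ hq)
      simp only [hgΘ, ct_eq t ht'', cr_eq r hr'', cθ_eq θ hθ]
      exact h
    have hcont : Continuous fun θ ↦ gΘ t r θ := cgΘ.comp (m_θ t r)
    rw [intervalIntegral.integral_eq_sub_of_hasDerivAt hderiv (hcont.intervalIntegrable _ _)]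
    have hπ' : Θ (boxPoint φ₀ t r π) = 0 := by
      simp only [hΘdef, tFluxTheta, boxPoint_apply_two, sin_pi, zero_mul]
    have h0' : Θ (boxPoint φ₀ t r 0) = 0 := by
      simp only [hΘdef, tFluxTheta, boxPoint_apply_two, sin_zero, zero_mul]
    rw [hπ', h0', sub_zero]
  /- Term A: the radial flux -/
  have hA : (∫ θ in (0 : ℝ)..π, ∫ r in r₁..r₂, ∫ t in t₁..t₂, gF t r θ) =
      ∫ t in t₁..t₂, ∫ θ in (0 : ℝ)..π, (F (boxPoint φ₀ t r₂ θ) - F (boxPoint φ₀ t r₁ θ)) := by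
    -- swap `r` and `t` inside
    have s1 : ∀ θ, (∫ r in r₁..r₂, ∫ t in t₁..t₂, gF t r θ) = ∫ t in t₁..t₂, ∫ r in r₁..r₂, gF t r θ := by
      intro θ
      have h : Continuous (Function.uncurry fun r t ↦ gF t r θ) := cgF.comp (m_rt θ)
      exact intervalIntegral_swap_continuous h hr ht
    have s1' : (∫ θ in (0 : ℝ)..π, ∫ r in r₁..r₂, ∫ t in t₁..t₂, gF t r θ) =
        ∫ θ in (0 : ℝ)..π, ∫ t in t₁..t₂, ∫ r in r₁..r₂, gF t r θ :=
      intervalIntegral.integral_congr fun θ _ ↦ s1 θ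
    rw [s1']
    -- FTC in `r`: the inner integral is `fF t r₂ θ − fF t r₁ θ` for `t ∈ [t₁, t₂]`, `θ ∈ [0, π]`
    have hftc : ∀ t ∈ Icc t₁ t₂, ∀ θ ∈ Icc (0 : ℝ) π,
        (∫ r in r₁..r₂, gF t r θ) = fF t r₂ θ - fF t r₁ θ := by
      intro t ht'' θ hθ
      have hderiv : ∀ r ∈ uIcc r₁ r₂, HasDerivAt (fun r' ↦ F (boxPoint φ₀ t r' θ)) (gF t r θ) r := by
        intro r hr'
        rw [uIcc_of_le hr] at hr'
        have hq := hbox t ht'' r hr' θ hθ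
        have h := hasDerivAt_comp_boxPoint_r (dF _ hq)
        simp only [hgF, ct_eq t ht'', cr_eq r hr', cθ_eq θ hθ]
        exact h
      have hcont : Continuous fun r ↦ gF t r θ := cgF.comp (m_r t θ)
      rw [intervalIntegral.integral_eq_sub_of_hasDerivAt hderiv (hcont.intervalIntegrable _ _)]
      simp only [hfF, ct_eq t ht'', cr_eq r₂ hr₂, cr_eq r₁ hr₁, cθ_eq θ hθ]
    -- swap `θ` and `t` (with the clamped boundary values, continuous everywhere)
    have hbdry : Continuous fun p : ℝ × ℝ ↦ fF p.2 r₂ p.1 - fF p.2 r₁ p.1 :=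
      (cfF.comp (Continuous.prodMk continuous_snd (Continuous.prodMk continuous_const continuous_fst))).sub
        (cfF.comp (Continuous.prodMk continuous_snd (Continuous.prodMk continuous_const continuous_fst)))
    have s2 : (∫ θ in (0 : ℝ)..π, ∫ t in t₁..t₂, ∫ r in r₁..r₂, gF t r θ) =
        ∫ θ in (0 : ℝ)..π, ∫ t in t₁..t₂, (fF t r₂ θ - fF t r₁ θ) := by
      refine intervalIntegral.integral_congr fun θ hθ ↦ ?_
      rw [uIcc_of_le hπ] at hθ
      refine intervalIntegral.integral_congr fun t ht' ↦ ?_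
      rw [uIcc_of_le ht] at ht'
      exact hftc t ht' θ hθ
    rw [s2]
    have s3 : (∫ θ in (0 : ℝ)..π, ∫ t in t₁..t₂, (fF t r₂ θ - fF t r₁ θ)) =
        ∫ t in t₁..t₂, ∫ θ in (0 : ℝ)..π, (fF t r₂ θ - fF t r₁ θ) := by
      have h : Continuous (Function.uncurry fun θ t ↦ fF t r₂ θ - fF t r₁ θ) := hbdry
      exact intervalIntegral_swap_continuous h hπ ht
    rw [s3]
    refine intervalIntegral.integral_congr fun t ht' ↦ ?_
    rw [uIcc_of_le ht] at ht'
    refine intervalIntegral.integral_congr fun θ hθ ↦ ?_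
    rw [uIcc_of_le hπ] at hθ
    simp only [hfF, ct_eq t ht', cr_eq r₂ hr₂, cr_eq r₁ hr₁, cθ_eq θ hθ]
  rw [hA, hB, add_zero]

/-- **The radial `T`-flux on the extremal horizon**: for `a = M`, at `r = M` (`Δ = (r − M)² = 0`)
`f_T[G] = 2M² sin θ (∂_{t*}G)² ≥ 0` — Aretakis 2012, §5.1: "similarly, we obtain
`∫_{𝓗⁺} J^T_μ[ψ] n^μ_{𝓗⁺} ≥ 0`" (on the horizon `J^T · ∇r = 2H (Tψ)(Kψ)` with `K` the null
generator, `= 2H(Tψ)²` for axisymmetric `ψ`). [cite: Aretakis2012, §5.1] -/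
theorem tFluxR_extremal_horizon (M : ℝ) (G : E4 → ℝ) {q : E4} (hq : q 1 = M) :
    tFluxR M M G q = 2 * M ^ 2 * sin (q 2) * pd 0 G q ^ 2 := by
  simp only [tFluxR, hq]
  ring

/-- **The `T`-energy identity between two leaves outside the extremal horizon.** For `a = M` and
the shell `{M ≤ r ≤ r₂}` of the coordinate box at `φ₀`:
`E(t₂) − E(t₁) = ∫_{t₁}^{t₂}∫₀^π (f_T[G](t, r₂, θ) − 2M² sin θ (∂_{t*}G)²(t, M, θ)) dθ dt`,
`E(t) = ∫₀^π∫_M^{r₂} e_T[G](t, r, θ) dr dθ` — the energy identity for the Killing field `T` on the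
region bounded by `Σ_{t₁}`, `Σ_{t₂}`, the horizon `{r = M}` and the cylinder `{r = r₂}`, with the
horizon flux `2M² sin θ (Tψ)² ≥ 0` explicit (Aretakis 2012, §5.1, Prop. 5.1.2 and the remark
before it). [cite: Aretakis2012, §5.1 (Prop. 5.1.2)] -/
theorem tEnergy_box_identity_extremal {M : ℝ} {W₀ : Set E4} (hW₀ : IsOpen W₀) {G : E4 → ℝ}
    (hG : ContDiffOn ℝ ∞ G W₀) (hP : ∀ q ∈ W₀, sin (q 2) ≠ 0 → radOp M M G q + angOp M G q = 0)
    {t₁ t₂ r₂ φ₀ : ℝ} (ht : t₁ ≤ t₂) (hr : M ≤ r₂)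
    (hbox : ∀ t ∈ Icc t₁ t₂, ∀ r ∈ Icc M r₂, ∀ θ ∈ Icc 0 π, boxPoint φ₀ t r θ ∈ W₀) :
    (∫ θ in (0 : ℝ)..π, ∫ r in M..r₂, tEnergy M M G (boxPoint φ₀ t₂ r θ)) -
        (∫ θ in (0 : ℝ)..π, ∫ r in M..r₂, tEnergy M M G (boxPoint φ₀ t₁ r θ)) =
      ∫ t in t₁..t₂, ∫ θ in (0 : ℝ)..π, (tFluxR M M G (boxPoint φ₀ t r₂ θ) -
        2 * M ^ 2 * sin θ * pd 0 G (boxPoint φ₀ t M θ) ^ 2) := by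
  rw [tEnergy_box_identity hW₀ hG hP ht hr hbox]
  refine intervalIntegral.integral_congr fun t _ ↦ ?_
  refine intervalIntegral.integral_congr fun θ _ ↦ ?_
  rw [tFluxR_extremal_horizon M G (boxPoint_apply_one φ₀ t M θ), boxPoint_apply_two]

/-- **Monotonicity of the degenerate `T`-energy and the horizon `T`-flux bound (extremal Kerr,
axisymmetric functions).** If moreover the radial flux vanishes on the outer cylinder `{r = r₂}`
for `t ∈ [t₁, t₂]` (e.g. `dG = 0` there: the wave has not reached `r₂`), then
`E(t₂) + ∫_{t₁}^{t₂}∫₀^π 2M² sin θ (∂_{t*}G)²(t, M, θ) dθ dt = E(t₁)`; in particular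
`E(t₂) ≤ E(t₁)` and the horizon flux is bounded by `E(t₁) − E(t₂)` (Aretakis 2012, §5.1,
Prop. 5.1.2: conservation of the degenerate energy `∫_{Σ_τ} J^T_μ[ψ]n^μ`, and
`∫_{𝓗⁺} J^T[ψ] ≥ 0`). [cite: Aretakis2012, §5.1 (Prop. 5.1.2)] -/
theorem tEnergy_extremal_conservation {M : ℝ} {W₀ : Set E4} (hW₀ : IsOpen W₀) {G : E4 → ℝ}
    (hG : ContDiffOn ℝ ∞ G W₀) (hP : ∀ q ∈ W₀, sin (q 2) ≠ 0 → radOp M M G q + angOp M G q = 0)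
    {t₁ t₂ r₂ φ₀ : ℝ} (ht : t₁ ≤ t₂) (hr : M ≤ r₂)
    (hbox : ∀ t ∈ Icc t₁ t₂, ∀ r ∈ Icc M r₂, ∀ θ ∈ Icc 0 π, boxPoint φ₀ t r θ ∈ W₀)
    (hfar : ∀ t ∈ Icc t₁ t₂, ∀ θ ∈ Icc (0 : ℝ) π, tFluxR M M G (boxPoint φ₀ t r₂ θ) = 0) :
    (∫ θ in (0 : ℝ)..π, ∫ r in M..r₂, tEnergy M M G (boxPoint φ₀ t₂ r θ)) +
        (∫ t in t₁..t₂, ∫ θ in (0 : ℝ)..π, 2 * M ^ 2 * sin θ * pd 0 G (boxPoint φ₀ t M θ) ^ 2) =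
      ∫ θ in (0 : ℝ)..π, ∫ r in M..r₂, tEnergy M M G (boxPoint φ₀ t₁ r θ) := by
  have h := tEnergy_box_identity_extremal hW₀ hG hP ht hr hbox
  have hzero : (∫ t in t₁..t₂, ∫ θ in (0 : ℝ)..π, (tFluxR M M G (boxPoint φ₀ t r₂ θ) -
      2 * M ^ 2 * sin θ * pd 0 G (boxPoint φ₀ t M θ) ^ 2)) =
      ∫ t in t₁..t₂, ∫ θ in (0 : ℝ)..π, -(2 * M ^ 2 * sin θ * pd 0 G (boxPoint φ₀ t M θ) ^ 2) := by
    refine intervalIntegral.integral_congr fun t ht' ↦ ?_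
    rw [uIcc_of_le ht] at ht'
    refine intervalIntegral.integral_congr fun θ hθ ↦ ?_
    rw [uIcc_of_le pi_pos.le] at hθ
    rw [hfar t ht' θ hθ, zero_sub]
  rw [hzero] at h
  simp only [intervalIntegral.integral_neg] at h
  linarith

/-- **Corollary: the degenerate `T`-energy of the shell `{M ≤ r ≤ r₂}` does not increase, and the
horizon `T`-flux is controlled by the initial energy** (both integrands being non-negative on
`[0, π]`). [cite: Aretakis2012, §5.1 (Prop. 5.1.2)] -/
theorem tEnergy_extremal_antitone {M : ℝ} {W₀ : Set E4} (hW₀ : IsOpen W₀) {G : E4 → ℝ}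
    (hG : ContDiffOn ℝ ∞ G W₀) (hP : ∀ q ∈ W₀, sin (q 2) ≠ 0 → radOp M M G q + angOp M G q = 0)
    {t₁ t₂ r₂ φ₀ : ℝ} (ht : t₁ ≤ t₂) (hr : M ≤ r₂)
    (hbox : ∀ t ∈ Icc t₁ t₂, ∀ r ∈ Icc M r₂, ∀ θ ∈ Icc 0 π, boxPoint φ₀ t r θ ∈ W₀)
    (hfar : ∀ t ∈ Icc t₁ t₂, ∀ θ ∈ Icc (0 : ℝ) π, tFluxR M M G (boxPoint φ₀ t r₂ θ) = 0) :
    (∫ θ in (0 : ℝ)..π, ∫ r in M..r₂, tEnergy M M G (boxPoint φ₀ t₂ r θ)) ≤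
        ∫ θ in (0 : ℝ)..π, ∫ r in M..r₂, tEnergy M M G (boxPoint φ₀ t₁ r θ) ∧
      (∫ t in t₁..t₂, ∫ θ in (0 : ℝ)..π, 2 * M ^ 2 * sin θ * pd 0 G (boxPoint φ₀ t M θ) ^ 2) ≤
        (∫ θ in (0 : ℝ)..π, ∫ r in M..r₂, tEnergy M M G (boxPoint φ₀ t₁ r θ)) -
          ∫ θ in (0 : ℝ)..π, ∫ r in M..r₂, tEnergy M M G (boxPoint φ₀ t₂ r θ) := by
  have h := tEnergy_extremal_conservation hW₀ hG hP ht hr hbox hfar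
  have hflux : 0 ≤ ∫ t in t₁..t₂, ∫ θ in (0 : ℝ)..π,
      2 * M ^ 2 * sin θ * pd 0 G (boxPoint φ₀ t M θ) ^ 2 :=
    intervalIntegral.integral_nonneg ht fun t _ ↦ intervalIntegral.integral_nonneg pi_pos.le
      fun θ hθ ↦ mul_nonneg (mul_nonneg (by positivity) (sin_nonneg_of_nonneg_of_le_pi hθ.1 hθ.2))
        (sq_nonneg _)
  constructor <;> linarith

end BoxIdentity

end StarCoord

end Kerr

end Literature.Geometry.Lorentzian

end
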